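import Mathlib
import HarnessLib
import Summits.HubbardSuperconductivity.HubbardSuperconductivity.Theorems.KLProgrammeKLRegimeSplitPairArrayV5

/-!
# Route `KLProgramme` — the in-class scale sum of the EDGE-LOCALISED sign-defect profile of the ladder weights (candidate Δ21, child 1 row 0′)

Cell gate-hubbard-kl, seat hubbard-kl-k3c1-p2.  Under the signed repair of the engine's (E2) clause the negative mass `Σ_p w_p⁻` of the
slice pair-bubble weights at pair momentum `Qm` and scale `n` is allowed up to `bhi·min 1 (c·|Qm|_𝕋·4ⁿ)` — VOID at the class edge, geometrically
small deep inside the class (`|Qm|_𝕋 ≤ 4^{-n}`), where the weights are in fact nonnegative by support geometry.  Row 0′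
(`betaSplitP_of_signedClauses`, `…KLRegimeBetaSplitSigned`) needs the per-pair-momentum sum of the allowance over the IN-CLASS scales to be
`O(bhi)`; here is the arithmetic: for `c ≤ 4^s` and `ρ ≤ 4^{-t}`, `Σ_{i<t} min 1 (c·ρ·4^{i+1}) ≤ s + 1 + 1/3` (the last `s + 1` in-class
scales contribute at most `1` each, the deeper ones a geometric tail `≤ 1/3`), and its `IsPairClassAt` form.  **`sum_min_one_edge_le`**,
**`sum_min_one_edge_le_of_isPairClassAt`**.  Everything is proved; no definitions.
-/

noncomputable section

namespace Summit.HubbardSuperconductivity.HubbardSuperconductivity.Theorems.KLRegimeSplit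

set_option linter.dupNamespace false -- summit = problem name (single-conjunct summit), D-0017

open Finset Literature.MathematicalPhysics.QuantumLattice Literature.Probability.LatticeModels

/-- **In-class scale sum of the edge profile.**  For `0 ≤ ρ ≤ 4^{-t}` and `c ≤ 4^s`:
`Σ_{i<t} min 1 (c·ρ·4^{i+1}) ≤ s + 1 + 1/3`. -/
theorem sum_min_one_edge_le {ρ c : ℝ} (hρ0 : 0 ≤ ρ) {s t : ℕ} (hc : c ≤ (4 : ℝ) ^ s)
    (hρ : ρ ≤ ((4 : ℝ) ^ t)⁻¹) : ∑ i ∈ range t, min 1 (c * ρ * (4 : ℝ) ^ (i + 1)) ≤ s + 1 + 1 / 3 := by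
  have h4t : (0 : ℝ) < (4 : ℝ) ^ t := by positivity
  -- termwise: `c·ρ·4^{i+1} ≤ 4^{s+i+1}·4^{-t}`
  have hterm : ∀ i, c * ρ * (4 : ℝ) ^ (i + 1) ≤ (4 : ℝ) ^ (s + (i + 1)) * ((4 : ℝ) ^ t)⁻¹ := by
    intro i
    have h1 : c * ρ ≤ (4 : ℝ) ^ s * ((4 : ℝ) ^ t)⁻¹ := mul_le_mul hc hρ hρ0 (by positivity)
    have h2 : (0 : ℝ) ≤ (4 : ℝ) ^ (i + 1) := by positivity
    calc c * ρ * (4 : ℝ) ^ (i + 1) ≤ (4 : ℝ) ^ s * ((4 : ℝ) ^ t)⁻¹ * (4 : ℝ) ^ (i + 1) :=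
          mul_le_mul_of_nonneg_right h1 h2
      _ = (4 : ℝ) ^ (s + (i + 1)) * ((4 : ℝ) ^ t)⁻¹ := by rw [pow_add (4 : ℝ) s (i + 1)]; ring
  -- split the scales at `K = t − (s+1)`
  set K : ℕ := t - (s + 1) with hK
  have hKt : K ≤ t := Nat.sub_le _ _
  rw [← sum_range_add_sum_Ico _ hKt]
  -- the deep part: a geometric tail `≤ 1/3`
  have hdeep : ∑ i ∈ range K, min 1 (c * ρ * (4 : ℝ) ^ (i + 1)) ≤ 1 / 3 := by
    rcases Nat.lt_or_ge t (s + 1) with hlt | hge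
    · have : K = 0 := by omega
      rw [this, sum_range_zero]; norm_num
    · have hKs : s + 1 + K = t := by omega
      calc ∑ i ∈ range K, min 1 (c * ρ * (4 : ℝ) ^ (i + 1))
          ≤ ∑ i ∈ range K, (4 : ℝ) ^ (s + (i + 1)) * ((4 : ℝ) ^ t)⁻¹ :=
            sum_le_sum fun i _ => (min_le_right _ _).trans (hterm i)
        _ = ((4 : ℝ) ^ (s + 1) * ((4 : ℝ) ^ t)⁻¹) * ∑ i ∈ range K, (4 : ℝ) ^ i := by
            rw [mul_sum]; refine sum_congr rfl fun i _ => ?_; rw [pow_add, pow_add, pow_add]; ring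
        _ = ((4 : ℝ) ^ (s + 1) * ((4 : ℝ) ^ t)⁻¹) * (((4 : ℝ) ^ K - 1) / (4 - 1)) := by rw [geom_sum_eq (by norm_num) K]
        _ = ((4 : ℝ) ^ (s + 1 + K) - (4 : ℝ) ^ (s + 1)) * ((4 : ℝ) ^ t)⁻¹ / 3 := by rw [pow_add (4 : ℝ) (s + 1) K]; ring
        _ = ((4 : ℝ) ^ t - (4 : ℝ) ^ (s + 1)) * ((4 : ℝ) ^ t)⁻¹ / 3 := by rw [hKs]
        _ = (1 - (4 : ℝ) ^ (s + 1) * ((4 : ℝ) ^ t)⁻¹) / 3 := by rw [sub_mul, mul_inv_cancel₀ h4t.ne']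
        _ ≤ 1 / 3 := by
            have : 0 ≤ (4 : ℝ) ^ (s + 1) * ((4 : ℝ) ^ t)⁻¹ := by positivity
            linarith
  -- the edge part: at most `s + 1` scales, each `≤ 1`
  have hedge : ∑ i ∈ Ico K t, min 1 (c * ρ * (4 : ℝ) ^ (i + 1)) ≤ s + 1 := by
    have h1 : ∑ i ∈ Ico K t, min 1 (c * ρ * (4 : ℝ) ^ (i + 1)) ≤ ∑ _i ∈ Ico K t, (1 : ℝ) :=
      sum_le_sum fun i _ => min_le_left _ _
    have h2 : ∑ _i ∈ Ico K t, (1 : ℝ) = (t - K : ℕ) := by rw [sum_const, Nat.card_Ico, nsmul_eq_mul, mul_one]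
    have h3 : ((t - K : ℕ) : ℝ) ≤ s + 1 := by
      have : t - K ≤ s + 1 := by omega
      exact_mod_cast this
    linarith
  linarith

/-- **The same at a pair-class scale**: `IsPairClassAt L Qm t` and `c ≤ 4^s` give
`Σ_{i<t} min 1 (c·|Qm|_𝕋·4^{i+1}) ≤ s + 1 + 1/3`. -/
theorem sum_min_one_edge_le_of_isPairClassAt {L : ℕ} [NeZero L] {Qm : TorusSite 2 L} {t : ℕ} (hQ : IsPairClassAt L Qm t) {c : ℝ}
    {s : ℕ} (hc : c ≤ (4 : ℝ) ^ s) :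
    ∑ i ∈ range t, min 1 (c * klTorusNorm L Qm * (4 : ℝ) ^ (i + 1)) ≤ s + 1 + 1 / 3 :=
  sum_min_one_edge_le (torusSupNorm_nonneg _) hc hQ

end Summit.HubbardSuperconductivity.HubbardSuperconductivity.Theorems.KLRegimeSplit

end
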